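import Summits.QuantumFields.BalabanUV.Beta.EriceRemainderEnclosureHistoryAutonomyComparisonMarkovCredit

/-!
# EriceRemainderEnclosureHistoryAutonomyComparisonMarkovCreditOrbit — (E139f) **MARKOV CREDIT WITH THE ORBIT'S OWN CEILING: in (E139b) the Markov slope is read at the
# a-priori ceiling `A + K·β̄` of the comparison window; here it is read at the perturbed orbit's OWN level `K` rows below, `1∕h′_{m+K}²` — legitimate because, once the
# dual steps are non-negative below the row `m`, every base orbit restarted in the window is AHEAD of `h′` (comparison from the later pins), and the one term that is
# not (the restart at `h′_m` itself) needs no damping.  ROW CONDITION along the orbit: `Σ_{k<K} Λ_k(1∕h′_m²)·Σ_{j<k} (1 + μ(1∕h′_{m+K}²))^{−(j+1)} ≤ 1` for every `m`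
# (+ deep moment `< 1`) ⟹ `h′ ≤ h` (`le_of_isotone_excess_markov_credit_orbit`).**  (E139b) follows (`1∕h′_{m+K}² ≤ 1∕h′_m² + Kβ̄`, `μ` antitone); for FAST orbits under
# a capped Markov pedestal — (E139e)'s family, where `β̄ ≥ sP` puts (E139b)'s ceiling above the cap — this is the form whose row quantity is `M̃(1 − (1+s)^{−L})∕s`
# (g107 `README.md` §4 (ζ); the formal instantiation on that family is the successor's item).

THE CHANGES relative to (E139a∕b).  `markov_gap_le_lev`: Markov damping of two base orbits with the ceiling given by EXPLICIT LEVEL BOUNDS on the higher orbit (not by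
`β̄` per scale).  `gap_le_sum_damped_pos`: in the region where the dual steps are non-negative, the window gap above `h′_n` is at most `Σ_{l≤k} d^{k−l} X_{n+l}` with
`d = (1+μ(Ā))⁻¹` for ANY `Ā ≥ 1∕h′_{n+1+k}²` — the higher orbit of each damped pair is `S(h′_{i+1})`, which comparison from the pin `h′_{i+1}` keeps below the levels of
`h′`.  `row_step_nonneg_orbit`: for `X_m < 0` the age-`k` gap splits as (restart bracket at `h′_m`, `≤ 0`) + (the age-`(k−1)` gap above `h′_{m+1}`, in the non-negative
region), so `Ā = 1∕h′_{m+K}²` serves every term; the credit at the rows `m+1, …` reads `μ` at levels `≤ 1∕h′_{m+K}²` as well.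

Cell `pub-balaban`, β-function sub-cell, BINDER row D4 «RemainderConst leaves for Bałaban's split» (`HOME/BINDER-OWNERS.md`; owner lineage `b2b-balaban-beta-an4`;
this file by co-owner #2 lineage `b2b-balaban-beta-d4-p2`, generation 107), β-FLOW TEAM duty (1), FREEZE (0) honoured (def-free; (E139a) `markov_gap_step` ∕
`credit_step_le` ∕ `exists_deep_row` ∕ `deep_steps_nonneg`, (E138b) `flow_source_le`, (E138a) `level_ge_pin_add` ∕ `dual_step_eq_levels`, (E132) `cmp_of_dual_steps_nonneg`,
(E48a) `family_mem` ∕ `family_tail_eq` ∕ `le_of_pin_le` ∕ `le_pin_of_memFlow` ∕ `memFlow_tail` ∕ `strictAnti_of_memFlow`, (E39) `exists_memFlow_zm`, (E43b)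
`memFlow_unique_of_monotone_zm` BY NAME; the row step repeats (E139b)'s with the orbit ceiling, nothing else restated).

HONEST FRAMING (page 1, verbatim and binding).  *"Discharging BetaPertH makes Bałaban's UV stability UNCONDITIONAL — a real constructive-QFT result; it is
NOT the continuum limit and NOT the Clay problem."*  THIS FILE DISCHARGES NOTHING OF THE KIND.  Elementary real analysis about ABSTRACT functionals on a box
]0,γ]^ℕ (node U2's `MemFlow` ∕ `SeqBox`) — hypotheses of a census, not facts; nothing about Bałaban's (1.22) limit functional is PRINTED in this form ([I] p. 298;
GAPS G-t4-U2-1∕-2) or asserted.  Row D4 class UNCHANGED (critical-path width 0; instance 0∕1; D4 DISCHARGE NO DATE).  NOT B12 Thm 2, NOT BetaPertH, NOT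
continuum YM, NOT Clay.

WHAT IS PROVED ([folklore]; 0 `def`, 0 sorry).  §1 **`markov_gap_le_lev`**.  §2 **`gap_le_sum_damped_pos`**.  §3 **`row_step_nonneg_orbit`**.  §4 `steps_nonneg_orbit`,
**`le_of_isotone_excess_markov_credit_orbit`**.
-/

noncomputable section
open Finset Set

namespace Summit.QuantumFields.BalabanUV.Beta.EriceRemainderEnclosureHistoryAutonomyComparisonMarkovCreditOrbit

open Literature.MathematicalPhysics.QuantumFieldTheory.Balaban1983to89
open Literature.MathematicalPhysics.QuantumFieldTheory.Balaban1983to89.T4BetaStationary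
open Literature.MathematicalPhysics.QuantumFieldTheory.Balaban1983to89.T4BetaFlowWellPosed
open Summit.QuantumFields.BalabanUV.Beta.EriceRemainderEnclosureHistoryAutonomyOrder
  (family_mem family_tail_eq le_of_pin_le le_pin_of_memFlow memFlow_tail strictAnti_of_memFlow)
open Summit.QuantumFields.BalabanUV.Beta.EriceRemainderEnclosureHistoryAutonomyComparisonDualOrbit (cmp_of_dual_steps_nonneg)
open Summit.QuantumFields.BalabanUV.Beta.EriceRemainderEnclosureHistoryAutonomyComparisonDualContractionLinks (level_ge_pin_add dual_step_eq_levels)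
open Summit.QuantumFields.BalabanUV.Beta.EriceRemainderEnclosureHistoryAutonomyComparisonDualContraction (flow_source_le)
open Summit.QuantumFields.BalabanUV.Beta.EriceRemainderEnclosureHistoryAutonomyComparisonMarkovCreditLinks
  (markov_gap_step credit_step_le exists_deep_row deep_steps_nonneg)

variable {B B' : (ℕ → ℝ) → ℝ} {M γ b βb : ℝ} {S : ℝ → ℕ → ℝ} {h h' : ℕ → ℝ} {μ : ℝ → ℝ} {Λ : ℕ → ℝ → ℝ} {K : ℕ}

/-! ## §1 Markov damping with an explicit level ceiling -/

/-- **MARKOV DAMPING, LEVEL CEILING.**  As (E139a) `markov_gap_le`, but the ceiling is given by explicit bounds on the levels of the higher orbit: two box solutions `k`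
(from `z`) and `k′ ≤ k` (from `z′`) of the isotone `B` with Markov lower slope `μ` (antitone, `≥ 0`); if `1∕k′_i² ≤ Ā` for all `i ≤ j` then
`1∕k′_j² − 1∕k_j² ≤ (1+μ(Ā))^{−j}·(1∕z′² − 1∕z²)`. [folklore] -/
theorem markov_gap_le_lev (hμ0 : ∀ A, 0 ≤ μ A) (hμanti : Antitone μ)
    (hmono : ∀ u v : ℕ → ℝ, SeqBox γ u → SeqBox γ v → (∀ i, u i ≤ v i) → B u ≤ B v)
    (hMk : ∀ u v : ℕ → ℝ, SeqBox γ u → SeqBox γ v → (∀ i, u (i + 1) = v (i + 1)) → v 0 ≤ u 0 →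
      B v + μ (1 / v 0 ^ 2) * (1 / v 0 ^ 2 - 1 / u 0 ^ 2) ≤ B u)
    {k k' : ℕ → ℝ} {z z' : ℝ} (hk : SeqBox γ k) (hfk : MemFlow B z k) (hk' : SeqBox γ k') (hfk' : MemFlow B z' k')
    (hle : ∀ i, k' i ≤ k i) {Abar : ℝ} :
    ∀ j : ℕ, (∀ i, i ≤ j → 1 / k' i ^ 2 ≤ Abar) →
      1 / k' j ^ 2 - 1 / k j ^ 2 ≤ ((1 + μ Abar)⁻¹) ^ j * (1 / z' ^ 2 - 1 / z ^ 2)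
  | 0 => fun _ => by rw [hfk.1, hfk'.1]; simp
  | j + 1 => fun hceil => by
    have ih := markov_gap_le_lev hμ0 hμanti hmono hMk hk hfk hk' hfk' hle j fun i hi => hceil i (Nat.le_succ_of_le hi)
    have hstep := markov_gap_step hmono hMk hk hfk hk' hfk' hle j
    have hp : 0 < k (j + 1) := (hk (j + 1)).1
    have hp' : 0 < k' (j + 1) := (hk' (j + 1)).1
    have hg0 : 0 ≤ 1 / k' (j + 1) ^ 2 - 1 / k (j + 1) ^ 2 :=
      sub_nonneg.mpr (one_div_le_one_div_of_le (pow_pos hp' 2) (pow_le_pow_left₀ hp'.le (hle (j + 1)) 2))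
    have hμle : μ Abar ≤ μ (1 / k' (j + 1) ^ 2) := hμanti (hceil (j + 1) le_rfl)
    have hd0 : 0 < 1 + μ Abar := by linarith [hμ0 Abar]
    have hkey : (1 / k' (j + 1) ^ 2 - 1 / k (j + 1) ^ 2) * (1 + μ Abar) ≤ 1 / k' j ^ 2 - 1 / k j ^ 2 :=
      (mul_le_mul_of_nonneg_left (by linarith) hg0).trans hstep
    have hdiv : 1 / k' (j + 1) ^ 2 - 1 / k (j + 1) ^ 2 ≤ (1 + μ Abar)⁻¹ * (1 / k' j ^ 2 - 1 / k j ^ 2) := by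
      rw [inv_mul_eq_div]; exact (le_div_iff₀ hd0).mpr hkey
    have hinv0 : 0 ≤ (1 + μ Abar)⁻¹ := inv_nonneg.mpr hd0.le
    calc 1 / k' (j + 1) ^ 2 - 1 / k (j + 1) ^ 2 ≤ (1 + μ Abar)⁻¹ * (1 / k' j ^ 2 - 1 / k j ^ 2) := hdiv
      _ ≤ (1 + μ Abar)⁻¹ * (((1 + μ Abar)⁻¹) ^ j * (1 / z' ^ 2 - 1 / z ^ 2)) := mul_le_mul_of_nonneg_left ih hinv0
      _ = ((1 + μ Abar)⁻¹) ^ (j + 1) * (1 / z' ^ 2 - 1 / z ^ 2) := by ring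

/-! ## §2 Damped window gaps in the non-negative region, ceiling from the orbit -/

/-- **DAMPED WINDOW GAPS WITH THE ORBIT'S CEILING.**  Base package with the Markov lower slope `μ`; `h′` a box solution of ANY `B′` whose dual steps are NON-NEGATIVE at
every row from `n` on.  Then for every `k` and every `Ā ≥ 1∕h′_{n+1+k}²`:  `1∕h′_{n+1+k}² − 1∕(S h′_n)_{1+k}² ≤ Σ_{l≤k} (1+μ(Ā))^{−(k−l)}·X_{n+l}` — each damped pair
consists of `S(h′_{i+1})` (higher) and the base orbit from `(S h′_i)_1`, and comparison from the pin `h′_{i+1}` ((E132) `cmp_of_dual_steps_nonneg`) keeps the levels of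
`S(h′_{i+1})` below those of `h′`, hence below `Ā` inside the window. [folklore] -/
theorem gap_le_sum_damped_pos (hb : 0 < b) (hμ0 : ∀ A, 0 ≤ μ A) (hμanti : Antitone μ)
    (hmono : ∀ u v : ℕ → ℝ, SeqBox γ u → SeqBox γ v → (∀ i, u i ≤ v i) → B u ≤ B v)
    (hB : ∀ u u' : ℕ → ℝ, SeqBox γ u → SeqBox γ u' → ∀ D : ℝ, (∀ j, |u j - u' j| ≤ D) → |B u - B u'| ≤ M * D) (hM : 0 ≤ M)
    (hlo : ∀ u, SeqBox γ u → b ≤ B u)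
    (hMk : ∀ u v : ℕ → ℝ, SeqBox γ u → SeqBox γ v → (∀ i, u (i + 1) = v (i + 1)) → v 0 ≤ u 0 →
      B v + μ (1 / v 0 ^ 2) * (1 / v 0 ^ 2 - 1 / u 0 ^ 2) ≤ B u)
    (hS : ∀ p, 0 < p → p ≤ γ → SeqBox γ (S p) ∧ MemFlow B p (S p))
    (huniq : ∀ p, 0 < p → p ≤ γ → ∀ u u' : ℕ → ℝ, SeqBox γ u → SeqBox γ u' → MemFlow B p u → MemFlow B p u' → u = u')
    (hexc : ∀ u, SeqBox γ u → B u ≤ B' u)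
    (hh' : SeqBox γ h') {y : ℝ} (hf' : MemFlow B' y h') {Abar : ℝ} :
    ∀ k n : ℕ, (∀ i, 0 ≤ 1 / h' (n + i + 1) ^ 2 - 1 / S (h' (n + i)) 1 ^ 2) → 1 / h' (n + 1 + k) ^ 2 ≤ Abar →
      1 / h' (n + 1 + k) ^ 2 - 1 / S (h' n) (1 + k) ^ 2
        ≤ ∑ l ∈ range (k + 1), ((1 + μ Abar)⁻¹) ^ (k - l) * (1 / h' (n + l + 1) ^ 2 - 1 / S (h' (n + l)) 1 ^ 2) := by
  have hlo' : ∀ u, SeqBox γ u → b ≤ B' u := fun u hu => (hlo u hu).trans (hexc u hu)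
  have hanti : Antitone h' := (strictAnti_of_memFlow hb hlo' hh' hf').antitone
  have hlevmono : ∀ i j : ℕ, i ≤ j → 1 / h' i ^ 2 ≤ 1 / h' j ^ 2 := fun i j hij =>
    one_div_le_one_div_of_le (pow_pos (hh' j).1 2) (pow_le_pow_left₀ (hh' j).1.le (hanti hij) 2)
  intro k
  induction k with
  | zero =>
    intro n _ _
    rw [zero_add, sum_range_one]
    simp only [add_zero, Nat.sub_zero, pow_zero, one_mul, le_refl]
  | succ k ih =>
    intro n hX hceil
    have hpn := hh' n
    have hq1 := hh' (n + 1)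
    have hq2m := family_mem hS hpn.1 hpn.2 1
    have hS1 := hS _ hq1.1 hq1.2
    have hS2 := hS _ hq2m.1 hq2m.2
    have e2 : S (h' n) (1 + (k + 1)) = S (S (h' n) 1) (1 + k) := by
      have := congrFun (family_tail_eq hS huniq hpn.1 hpn.2 1) (1 + k)
      simpa [Nat.add_comm, Nat.add_assoc] using this
    have e1 : n + 1 + (k + 1) = (n + 1) + 1 + k := by omega
    have hX' : ∀ i, 0 ≤ 1 / h' (n + 1 + i + 1) ^ 2 - 1 / S (h' (n + 1 + i)) 1 ^ 2 := fun i => by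
      have := hX (i + 1); rw [show n + (i + 1) = n + 1 + i by omega] at this; exact this
    have ihn := ih (n + 1) hX' (by rw [← e1]; exact hceil)
    -- comparison from the pin h′_{n+1}: the levels of S(h′_{n+1}) stay below those of h′
    have htailbox : SeqBox γ (fun i => h' (n + 1 + i)) := fun i => hh' (n + 1 + i)
    have htailflow : MemFlow B' (h' (n + 1)) (fun i => h' (n + 1 + i)) := memFlow_tail hf' (n + 1)
    have hcmp : ∀ j, h' (n + 1 + j) ≤ S (h' (n + 1)) j := by
      intro j
      have := cmp_of_dual_steps_nonneg (B' := B') hb hB hM hlo hS huniq hq1.1 hq1.2 htailbox htailflow j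
        (fun i _ => by
          have h1 := hX' i
          have heq := dual_step_eq_levels hS hh' hf' (n + 1 + i)
          have e : (fun i_1 => h' (n + 1 + (i + 1 + i_1))) = (fun i_1 => h' (n + 1 + i + 1 + i_1)) := by
            funext q; simp [Nat.add_assoc]
          rw [e]; linarith) j le_rfl
      simpa using this
    -- the bracket: pins h′_{n+1} ≤ (S h′_n)_1 (X_n ≥ 0), damped with the ceiling Ā
    have hXn : 0 ≤ 1 / h' (n + 1) ^ 2 - 1 / S (h' n) 1 ^ 2 := by have := hX 0; simpa using this
    have hle : h' (n + 1) ≤ S (h' n) 1 := by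
      by_contra hlt0
      have hlt : S (h' n) 1 < h' (n + 1) := lt_of_not_ge hlt0
      have hqS : 0 < S (h' n) 1 := hq2m.1
      have : 1 / h' (n + 1) ^ 2 < 1 / S (h' n) 1 ^ 2 :=
        one_div_lt_one_div_of_lt (pow_pos hqS 2) (pow_lt_pow_left₀ hlt hqS.le two_ne_zero)
      linarith
    have hcomp : ∀ i, S (h' (n + 1)) i ≤ S (S (h' n) 1) i := fun i =>
      le_of_pin_le hb hB hM hlo huniq hq1.1 hle hq2m.2 hS1.1 hS2.1 hS1.2 hS2.2 i
    have hbr : 1 / S (h' (n + 1)) (1 + k) ^ 2 - 1 / S (S (h' n) 1) (1 + k) ^ 2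
        ≤ ((1 + μ Abar)⁻¹) ^ (k + 1) * (1 / h' (n + 1) ^ 2 - 1 / S (h' n) 1 ^ 2) := by
      have hmk := markov_gap_le_lev hμ0 hμanti hmono hMk hS2.1 hS2.2 hS1.1 hS1.2 hcomp (Abar := Abar) (1 + k) (fun i hi => by
        have h1 : 1 / S (h' (n + 1)) i ^ 2 ≤ 1 / h' (n + 1 + i) ^ 2 :=
          one_div_le_one_div_of_le (pow_pos (hh' _).1 2) (pow_le_pow_left₀ (hh' _).1.le (hcmp i) 2)
        exact h1.trans ((hlevmono _ _ (by omega)).trans hceil))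
      rw [show k + 1 = 1 + k by omega]; exact hmk
    have hre : ∑ l ∈ range (k + 1 + 1), ((1 + μ Abar)⁻¹) ^ (k + 1 - l) * (1 / h' (n + l + 1) ^ 2 - 1 / S (h' (n + l)) 1 ^ 2)
        = ∑ l ∈ range (k + 1), ((1 + μ Abar)⁻¹) ^ (k - l) * (1 / h' (n + 1 + l + 1) ^ 2 - 1 / S (h' (n + 1 + l)) 1 ^ 2)
          + ((1 + μ Abar)⁻¹) ^ (k + 1) * (1 / h' (n + 1) ^ 2 - 1 / S (h' n) 1 ^ 2) := by
      rw [sum_range_succ']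
      congr 1
      · refine sum_congr rfl fun l hl => ?_
        have hl' : l < k + 1 := mem_range.mp hl
        rw [show k + 1 - (l + 1) = k - l by omega, show n + (l + 1) + 1 = n + 1 + l + 1 by omega,
          show n + (l + 1) = n + 1 + l by omega]
    rw [e1, e2, hre]
    linarith [ihn, hbr]


/-! ## §3 The row step with the orbit's ceiling -/

/-- **THE ROW STEP, ORBIT CEILING.**  As (E139b) `row_step_nonneg` with the ROW CONDITION `Σ_{k<K} Λ_k(1∕h′_m²)·Σ_{j<k} d^{j+1} ≤ 1`, `d = (1 + μ(1∕h′_{m+K}²))⁻¹` — the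
Markov slope read at the perturbed orbit's own level `K` rows below: if the dual steps are non-negative at every row below `m`, then `X_m ≥ 0`. [folklore] -/
theorem row_step_nonneg_orbit (hb : 0 < b) (hμ0 : ∀ A, 0 ≤ μ A) (hμanti : Antitone μ)
    (hmono : ∀ u v : ℕ → ℝ, SeqBox γ u → SeqBox γ v → (∀ i, u i ≤ v i) → B u ≤ B v)
    (hB : ∀ u u' : ℕ → ℝ, SeqBox γ u → SeqBox γ u' → ∀ D : ℝ, (∀ j, |u j - u' j| ≤ D) → |B u - B u'| ≤ M * D) (hM : 0 ≤ M)
    (hlo : ∀ u, SeqBox γ u → b ≤ B u)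
    (hMk : ∀ u v : ℕ → ℝ, SeqBox γ u → SeqBox γ v → (∀ i, u (i + 1) = v (i + 1)) → v 0 ≤ u 0 →
      B v + μ (1 / v 0 ^ 2) * (1 / v 0 ^ 2 - 1 / u 0 ^ 2) ≤ B u)
    (hS : ∀ p, 0 < p → p ≤ γ → SeqBox γ (S p) ∧ MemFlow B p (S p))
    (huniq : ∀ p, 0 < p → p ≤ γ → ∀ u u' : ℕ → ℝ, SeqBox γ u → SeqBox γ u' → MemFlow B p u → MemFlow B p u' → u = u')
    (hΛ : ∀ k A, 0 ≤ Λ k A)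
    (hLip : ∀ A : ℝ, ∀ u v : ℕ → ℝ, SeqBox γ u → SeqBox γ v → (∀ k : ℕ, A + ((k : ℝ) + 1) * b ≤ 1 / u k ^ 2) →
      (∀ k : ℕ, A + ((k : ℝ) + 1) * b ≤ 1 / v k ^ 2) → B u - B v ≤ ∑ k ∈ range K, Λ k A * max (1 / v k ^ 2 - 1 / u k ^ 2) 0)
    (hexc : ∀ u, SeqBox γ u → B u ≤ B' u)
    (hDmono : ∀ u v : ℕ → ℝ, SeqBox γ u → SeqBox γ v → (∀ i, u i ≤ v i) → B' u - B u ≤ B' v - B v)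
    (hh' : SeqBox γ h') {y : ℝ} (hf' : MemFlow B' y h') (m : ℕ)
    (hrow : ∑ k ∈ range K, Λ k (1 / h' m ^ 2) * ∑ j ∈ range k, ((1 + μ (1 / h' (m + K) ^ 2))⁻¹) ^ (j + 1) ≤ 1)
    (hbelow : ∀ n, m < n → 0 ≤ 1 / h' (n + 1) ^ 2 - 1 / S (h' n) 1 ^ 2) :
    0 ≤ 1 / h' (m + 1) ^ 2 - 1 / S (h' m) 1 ^ 2 := by
  by_contra hneg0
  have hneg : 1 / h' (m + 1) ^ 2 - 1 / S (h' m) 1 ^ 2 < 0 := lt_of_not_ge hneg0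
  set A : ℝ := 1 / h' m ^ 2 with hA
  set d : ℝ := (1 + μ (1 / h' (m + K) ^ 2))⁻¹ with hd
  have hlo' : ∀ u, SeqBox γ u → b ≤ B' u := fun u hu => (hlo u hu).trans (hexc u hu)
  have hanti : Antitone h' := (strictAnti_of_memFlow hb hlo' hh' hf').antitone
  have hlevmono : ∀ i j : ℕ, i ≤ j → 1 / h' i ^ 2 ≤ 1 / h' j ^ 2 := fun i j hij =>
    one_div_le_one_div_of_le (pow_pos (hh' j).1 2) (pow_le_pow_left₀ (hh' j).1.le (hanti hij) 2)
  have hd1 : 0 < 1 + μ (1 / h' (m + K) ^ 2) := by linarith [hμ0 (1 / h' (m + K) ^ 2)]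
  have hd0 : 0 ≤ d := inv_nonneg.mpr hd1.le
  have hpm := hh' m
  have hSm := hS (h' m) hpm.1 hpm.2
  have htailbox : SeqBox γ (fun i => h' (m + i)) := fun i => hh' (m + i)
  have htailflow : MemFlow B' (h' m) (fun i => h' (m + i)) := memFlow_tail hf' m
  -- the perturbed coupling exceeds the base's at scale 1
  have hq1 : 0 < h' (m + 1) := (hh' (m + 1)).1
  have hqS : 0 < S (h' m) 1 := (hSm.1 1).1
  have hlt : S (h' m) 1 < h' (m + 1) := by
    by_contra hge0
    have hge : h' (m + 1) ≤ S (h' m) 1 := le_of_not_gt hge0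
    have : 1 / h' (m + 1) ^ 2 ≥ 1 / S (h' m) 1 ^ 2 :=
      one_div_le_one_div_of_le (pow_pos hq1 2) (pow_le_pow_left₀ hq1.le hge 2)
    linarith
  -- the three configurations
  set u : ℕ → ℝ := fun i => S (h' m) (1 + i) with hu
  set v : ℕ → ℝ := fun i => h' (m + 1 + i) with hv
  set w : ℕ → ℝ := fun i => if i = 0 then h' (m + 1) else S (h' m) (1 + i) with hw
  have hubox : SeqBox γ u := fun i => hSm.1 (1 + i)
  have hvbox : SeqBox γ v := fun i => hh' (m + 1 + i)
  have hwbox : SeqBox γ w := by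
    intro i
    by_cases hi : i = 0
    · simp only [hw, hi, if_true]; exact hh' (m + 1)
    · simp only [hw, hi, if_false]; exact hSm.1 (1 + i)
  have hBuw : B u ≤ B w := by
    refine hmono _ _ hubox hwbox fun i => ?_
    by_cases hi : i = 0
    · subst hi; simp only [hu, hw, if_true, add_zero]; exact hlt.le
    · simp [hu, hw, hi]
  have hgw : ∀ k : ℕ, A + ((k : ℝ) + 1) * b ≤ 1 / w k ^ 2 := by
    intro k
    by_cases hk : k = 0
    · subst hk
      simp only [hw, if_true, Nat.cast_zero, zero_add, one_mul]
      rw [hA, hf'.2 m]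
      linarith [hlo' _ (seqBox_shift hh' (m + 1))]
    · simp only [hw, hk, if_false]
      have := level_ge_pin_add hlo hSm.1 hSm.2 (1 + k)
      push_cast at this
      rw [hA]; linarith
  have hgv : ∀ k : ℕ, A + ((k : ℝ) + 1) * b ≤ 1 / v k ^ 2 := by
    intro k
    have := level_ge_pin_add hlo' htailbox htailflow (1 + k)
    push_cast at this
    simp only [hv]
    rw [hA, show m + 1 + k = m + (1 + k) by omega]; linarith
  have hprof := hLip A w v hwbox hvbox hgw hgv
  -- the credit below: X_{m+l+1} ≤ d · E_m for l + 2 ≤ K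
  have hcredit : ∀ l : ℕ, l + 2 ≤ K →
      1 / h' (m + 1 + l + 1) ^ 2 - 1 / S (h' (m + 1 + l)) 1 ^ 2 ≤ d * (B' (fun i => h' (m + 1 + i)) - B (fun i => h' (m + 1 + i))) := by
    intro l hl
    have hXn : 0 ≤ 1 / h' (m + 1 + l + 1) ^ 2 - 1 / S (h' (m + 1 + l)) 1 ^ 2 := hbelow _ (by omega)
    have hc := credit_step_le (B' := B') (μ := μ) hb hmono hB hM hlo hMk hS huniq hh' hf' (m + 1 + l)
      (fun i => by
        have := hbelow (m + 1 + l + i) (by omega)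
        simpa [Nat.add_assoc] using this)
    have hμle : μ (1 / h' (m + K) ^ 2) ≤ μ (1 / h' (m + 1 + l + 1) ^ 2) := hμanti (hlevmono _ _ (by omega))
    have hsrc : B' (fun i => h' (m + (l + 1) + 1 + i)) - B (fun i => h' (m + (l + 1) + 1 + i))
        ≤ B' (fun i => h' (m + 1 + i)) - B (fun i => h' (m + 1 + i)) := flow_source_le hb hlo' hDmono hh' hf' m l
    rw [show m + (l + 1) + 1 = m + 1 + l + 1 by omega] at hsrc
    have hkey : (1 + μ (1 / h' (m + K) ^ 2)) * (1 / h' (m + 1 + l + 1) ^ 2 - 1 / S (h' (m + 1 + l)) 1 ^ 2)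
        ≤ B' (fun i => h' (m + 1 + i)) - B (fun i => h' (m + 1 + i)) :=
      ((mul_le_mul_of_nonneg_right (by linarith) hXn).trans hc).trans hsrc
    rw [hd, inv_mul_eq_div, le_div_iff₀ hd1, mul_comm]
    exact hkey
  -- each window gap is at most E_m · Σ_{j<k} d^{j+1}
  have hD : ∀ k ∈ range K, Λ k A * max (1 / v k ^ 2 - 1 / w k ^ 2) 0
      ≤ Λ k A * ((B' (fun i => h' (m + 1 + i)) - B (fun i => h' (m + 1 + i))) * ∑ j ∈ range k, d ^ (j + 1)) := by
    intro k hk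
    have hkK : k < K := mem_range.mp hk
    refine mul_le_mul_of_nonneg_left ?_ (hΛ k A)
    have hE0 : 0 ≤ B' (fun i => h' (m + 1 + i)) - B (fun i => h' (m + 1 + i)) := sub_nonneg.mpr (hexc _ hvbox)
    have hrhs0 : 0 ≤ (B' (fun i => h' (m + 1 + i)) - B (fun i => h' (m + 1 + i))) * ∑ j ∈ range k, d ^ (j + 1) :=
      mul_nonneg hE0 (sum_nonneg fun j _ => pow_nonneg hd0 _)
    refine max_le ?_ hrhs0
    rcases Nat.eq_zero_or_pos k with hk0 | hkpos
    · subst hk0; simp [hv, hw]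
    · obtain ⟨k', rfl⟩ := Nat.exists_eq_add_of_le' hkpos
      simp only [hv, hw, Nat.succ_ne_zero, if_false]
      -- split: restart bracket at h′_m (≤ 0) + the age-k′ gap above h′_{m+1} (non-negative region)
      have hq2m := family_mem hS hpm.1 hpm.2 1
      have hS1 := hS _ (hh' (m + 1)).1 (hh' (m + 1)).2
      have hS2 := hS _ hq2m.1 hq2m.2
      have e2 : S (h' m) (1 + (k' + 1)) = S (S (h' m) 1) (1 + k') := by
        have := congrFun (family_tail_eq hS huniq hpm.1 hpm.2 1) (1 + k')
        simpa [Nat.add_comm, Nat.add_assoc] using this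
      have hcomp : ∀ i, S (S (h' m) 1) i ≤ S (h' (m + 1)) i := fun i =>
        le_of_pin_le hb hB hM hlo huniq hq2m.1 hlt.le (hh' (m + 1)).2 hS2.1 hS1.1 hS2.2 hS1.2 i
      have hbr0 : 1 / S (h' (m + 1)) (1 + k') ^ 2 - 1 / S (S (h' m) 1) (1 + k') ^ 2 ≤ 0 := by
        have hpa : 0 < S (S (h' m) 1) (1 + k') := (hS2.1 (1 + k')).1
        exact sub_nonpos.mpr (one_div_le_one_div_of_le (pow_pos hpa 2) (pow_le_pow_left₀ hpa.le (hcomp (1 + k')) 2))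
      have hpos := gap_le_sum_damped_pos (B' := B') (Abar := 1 / h' (m + K) ^ 2) hb hμ0 hμanti hmono hB hM hlo hMk hS huniq hexc hh' hf' k' (m + 1)
        (fun i => hbelow (m + 1 + i) (by omega)) (hlevmono _ _ (by omega))
      rw [← hd] at hpos
      -- the damped sum of the (non-negative) steps below is at most E_m · Σ_{j<k′+1} d^{j+1}
      have hsum : ∑ l ∈ range (k' + 1), d ^ (k' - l) * (1 / h' (m + 1 + l + 1) ^ 2 - 1 / S (h' (m + 1 + l)) 1 ^ 2)
          ≤ (B' (fun i => h' (m + 1 + i)) - B (fun i => h' (m + 1 + i))) * ∑ j ∈ range (k' + 1), d ^ (j + 1) := by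
        rw [mul_sum, ← sum_range_reflect (fun j => (B' (fun i => h' (m + 1 + i)) - B (fun i => h' (m + 1 + i))) * d ^ (j + 1)) (k' + 1)]
        refine sum_le_sum fun l hl => ?_
        have hlk : l < k' + 1 := mem_range.mp hl
        rw [show k' + 1 - 1 - l + 1 = k' - l + 1 by omega, show d ^ (k' - l + 1) = d ^ (k' - l) * d from pow_succ d (k' - l)]
        have hc := hcredit l (by omega)
        have := mul_le_mul_of_nonneg_left hc (pow_nonneg hd0 (k' - l))
        linarith
      rw [show m + 1 + (k' + 1) = (m + 1) + 1 + k' by omega, e2]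
      linarith
  -- assemble: E_m − X_m ≤ E_m · ROW ≤ E_m
  have heq := dual_step_eq_levels hS hh' hf' m
  have hE0 : 0 ≤ B' (fun i => h' (m + 1 + i)) - B (fun i => h' (m + 1 + i)) := sub_nonneg.mpr (hexc _ hvbox)
  have htot : B w - B v ≤ (B' (fun i => h' (m + 1 + i)) - B (fun i => h' (m + 1 + i)))
      * ∑ k ∈ range K, Λ k A * ∑ j ∈ range k, d ^ (j + 1) := by
    refine hprof.trans ((sum_le_sum hD).trans_eq ?_)
    rw [mul_sum]
    exact sum_congr rfl fun k _ => by ring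
  have hrow' : ∑ k ∈ range K, Λ k A * ∑ j ∈ range k, d ^ (j + 1) ≤ 1 := by rw [hA, hd]; exact hrow
  have hfin : B w - B v ≤ B' (fun i => h' (m + 1 + i)) - B (fun i => h' (m + 1 + i)) := by
    have := mul_le_mul_of_nonneg_left hrow' hE0
    linarith
  have hBv : B (fun i => h' (m + 1 + i)) = B v := rfl
  have hBu : B (fun i => S (h' m) (1 + i)) = B u := rfl
  linarith [hBuw, hfin, heq]

/-! ## §4 Comparison with the orbit's ceiling -/

/-- All dual steps are non-negative under the orbit-ceiling row condition at every row and a deep age moment below one ((E139a) `deep_steps_nonneg` + backward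
induction `row_step_nonneg_orbit`). [folklore] -/
theorem steps_nonneg_orbit (hb : 0 < b) (hμ0 : ∀ A, 0 ≤ μ A) (hμanti : Antitone μ)
    (hmono : ∀ u v : ℕ → ℝ, SeqBox γ u → SeqBox γ v → (∀ i, u i ≤ v i) → B u ≤ B v)
    (hB : ∀ u u' : ℕ → ℝ, SeqBox γ u → SeqBox γ u' → ∀ D : ℝ, (∀ j, |u j - u' j| ≤ D) → |B u - B u'| ≤ M * D) (hM : 0 ≤ M)
    (hlo : ∀ u, SeqBox γ u → b ≤ B u)
    (hMk : ∀ u v : ℕ → ℝ, SeqBox γ u → SeqBox γ v → (∀ i, u (i + 1) = v (i + 1)) → v 0 ≤ u 0 →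
      B v + μ (1 / v 0 ^ 2) * (1 / v 0 ^ 2 - 1 / u 0 ^ 2) ≤ B u)
    (hS : ∀ p, 0 < p → p ≤ γ → SeqBox γ (S p) ∧ MemFlow B p (S p))
    (huniq : ∀ p, 0 < p → p ≤ γ → ∀ u u' : ℕ → ℝ, SeqBox γ u → SeqBox γ u' → MemFlow B p u → MemFlow B p u' → u = u')
    (hΛ : ∀ k A, 0 ≤ Λ k A)
    (hLip : ∀ A : ℝ, ∀ u v : ℕ → ℝ, SeqBox γ u → SeqBox γ v → (∀ k : ℕ, A + ((k : ℝ) + 1) * b ≤ 1 / u k ^ 2) →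
      (∀ k : ℕ, A + ((k : ℝ) + 1) * b ≤ 1 / v k ^ 2) → B u - B v ≤ ∑ k ∈ range K, Λ k A * max (1 / v k ^ 2 - 1 / u k ^ 2) 0)
    (hdeep : ∃ A₀ : ℝ, ∀ A, A₀ ≤ A → ∑ k ∈ range K, (k : ℝ) * Λ k A < 1)
    (hexc : ∀ u, SeqBox γ u → B u ≤ B' u) (hbdd : ∀ u, SeqBox γ u → B' u ≤ βb)
    (hDmono : ∀ u v : ℕ → ℝ, SeqBox γ u → SeqBox γ v → (∀ i, u i ≤ v i) → B' u - B u ≤ B' v - B v)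
    (hh' : SeqBox γ h') {y : ℝ} (hf' : MemFlow B' y h')
    (hrow : ∀ m : ℕ, ∑ k ∈ range K, Λ k (1 / h' m ^ 2) * ∑ j ∈ range k, ((1 + μ (1 / h' (m + K) ^ 2))⁻¹) ^ (j + 1) ≤ 1) :
    ∀ n, 0 ≤ 1 / h' (n + 1) ^ 2 - 1 / S (h' n) 1 ^ 2 := by
  obtain ⟨A₀, hA₀⟩ := hdeep
  have hlo' : ∀ u, SeqBox γ u → b ≤ B' u := fun u hu => (hlo u hu).trans (hexc u hu)
  obtain ⟨N, hN⟩ := exists_deep_row hb hlo' hh' hf' A₀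
  have hdeepN := deep_steps_nonneg hb hmono hB hM hlo hS huniq hΛ hLip hexc hbdd hDmono hh' hf' N (hA₀ _ hN)
  have key : ∀ i : ℕ, ∀ n, N - i ≤ n → 0 ≤ 1 / h' (n + 1) ^ 2 - 1 / S (h' n) 1 ^ 2 := by
    intro i
    induction i with
    | zero => intro n hn; exact hdeepN n (by simpa using hn)
    | succ i ih =>
      intro n hn
      by_cases hni : N - i ≤ n
      · exact ih n hni
      · exact row_step_nonneg_orbit hb hμ0 hμanti hmono hB hM hlo hMk hS huniq hΛ hLip hexc hDmono hh' hf' n (hrow n)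
          fun n' hn' => ih n' (by omega)
  intro n
  exact key N n (by omega)

/-- **COMPARISON WITH MARKOV CREDIT AT THE ORBIT'S OWN CEILING.**  Base package (isotone, floor `b > 0`, zeroth moment), level-graded profile `Λ_k(A) ≥ 0` on the graded
box above every level `A`, deep moment `< 1`, Markov lower slope `μ ≥ 0` antitone; `B ≤ B′ ≤ β̄` with isotone excess; `h, h′` box solutions of `B, B′` from one pin.  If at
every row `m` **`Σ_{k<K} Λ_k(1∕h′_m²)·Σ_{j<k} (1 + μ(1∕h′_{m+K}²))^{−(j+1)} ≤ 1`** then `h′ ≤ h` at every scale.  (E139b) is the case where `μ` is read at the cruder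
ceiling `1∕h′_m² + Kβ̄ ≥ 1∕h′_{m+K}²`. [folklore] -/
theorem le_of_isotone_excess_markov_credit_orbit {p : ℝ}
    (hmono : ∀ u v : ℕ → ℝ, SeqBox γ u → SeqBox γ v → (∀ i, u i ≤ v i) → B u ≤ B v)
    (hB : ∀ u u' : ℕ → ℝ, SeqBox γ u → SeqBox γ u' → ∀ D : ℝ, (∀ j, |u j - u' j| ≤ D) → |B u - B u'| ≤ M * D) (hM : 0 ≤ M)
    (hb : 0 < b) (hlo : ∀ u, SeqBox γ u → b ≤ B u)
    (hΛ : ∀ k A, 0 ≤ Λ k A)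
    (hLip : ∀ A : ℝ, ∀ u v : ℕ → ℝ, SeqBox γ u → SeqBox γ v → (∀ k : ℕ, A + ((k : ℝ) + 1) * b ≤ 1 / u k ^ 2) →
      (∀ k : ℕ, A + ((k : ℝ) + 1) * b ≤ 1 / v k ^ 2) → B u - B v ≤ ∑ k ∈ range K, Λ k A * max (1 / v k ^ 2 - 1 / u k ^ 2) 0)
    (hdeep : ∃ A₀ : ℝ, ∀ A, A₀ ≤ A → ∑ k ∈ range K, (k : ℝ) * Λ k A < 1)
    (hμ0 : ∀ A, 0 ≤ μ A) (hμanti : Antitone μ)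
    (hMk : ∀ u v : ℕ → ℝ, SeqBox γ u → SeqBox γ v → (∀ i, u (i + 1) = v (i + 1)) → v 0 ≤ u 0 →
      B v + μ (1 / v 0 ^ 2) * (1 / v 0 ^ 2 - 1 / u 0 ^ 2) ≤ B u)
    (hexc : ∀ u, SeqBox γ u → B u ≤ B' u) (hbdd : ∀ u, SeqBox γ u → B' u ≤ βb)
    (hDmono : ∀ u v : ℕ → ℝ, SeqBox γ u → SeqBox γ v → (∀ i, u i ≤ v i) → B' u - B u ≤ B' v - B v)
    (hp : 0 < p) (hpγ : p ≤ γ) (hh : SeqBox γ h) (hf : MemFlow B p h) (hh' : SeqBox γ h') (hf' : MemFlow B' p h')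
    (hrow : ∀ m : ℕ, ∑ k ∈ range K, Λ k (1 / h' m ^ 2) * ∑ j ∈ range k, ((1 + μ (1 / h' (m + K) ^ 2))⁻¹) ^ (j + 1) ≤ 1) (j : ℕ) :
    h' j ≤ h j := by
  have hex : ∀ q : ℝ, 0 < q → q ≤ γ → ∃ k : ℕ → ℝ, SeqBox γ k ∧ MemFlow B q k :=
    fun q hq hqγ => Summit.QuantumFields.BalabanUV.Beta.EriceRemainderEnclosureHistoryAutonomyExistence.exists_memFlow_zm hB hM hq hqγ hb hlo
  choose! S hSb hSf using hex
  have hS : ∀ q, 0 < q → q ≤ γ → SeqBox γ (S q) ∧ MemFlow B q (S q) := fun q hq hqγ => ⟨hSb q hq hqγ, hSf q hq hqγ⟩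
  have huniq : ∀ q, 0 < q → q ≤ γ → ∀ u u' : ℕ → ℝ, SeqBox γ u → SeqBox γ u' → MemFlow B q u → MemFlow B q u' → u = u' :=
    fun q hq _ u u' hu hu' hfu hfu' =>
      Summit.QuantumFields.BalabanUV.Beta.EriceRemainderEnclosureHistoryAutonomyMonotoneGeneral.memFlow_unique_of_monotone_zm hmono hB hM hq hb hlo hu hu' hfu hfu'
  have e : h = S p := huniq p hp hpγ _ _ hh (hS p hp hpγ).1 hf (hS p hp hpγ).2
  rw [e]
  refine cmp_of_dual_steps_nonneg (B' := B') hb hB hM hlo hS huniq hp hpγ hh' hf' j (fun i _ => ?_) j le_rfl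
  have h0 := steps_nonneg_orbit hb hμ0 hμanti hmono hB hM hlo hMk hS huniq hΛ hLip hdeep hexc hbdd hDmono hh' hf' hrow i
  have heq := dual_step_eq_levels hS hh' hf' i
  linarith

end Summit.QuantumFields.BalabanUV.Beta.EriceRemainderEnclosureHistoryAutonomyComparisonMarkovCreditOrbit

end
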